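import Summits.ValiantsHypothesis.ValiantsHypothesis.Theorems.KPlusLogSqLawStaticPathFoldCount
import Summits.ValiantsHypothesis.ValiantsHypothesis.Theorems.KPlusLogSqLawStaticPathTrainDefs

/-!
# Route «KPlusLogSqLaw» — the ALTERNATING FOLD LEMMA, part 3: the left train of a path block

HONEST FRAMING.  Helper toward the crux `WeakLifting` (item `stmt-ValiantsHypothesis-19561`, route `KPlusLogSqLaw`, cell
`pub-symmetroid`, seat val-sym-lift-p3 g6, 2026-08-27) on the line of its witness-plan stub `stub_tridiagonalSectorB`: the tropical twin
of the STATIC tridiagonal sector is parametric maximum-weight independent set on a path (val-sym-lift-p4 g6,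
`HOME/val-sym-lift-p4/STATIC-PATH-NLOGN.md`).  This file links the path DP to the alternating fold of parts 1–2: the left train is the
increment of the prefix optimum (`F_succ_eq`, `Δ_nonneg`), the FOLD of the signed prefix-sum lines `S_t = Σ_{i ≤ t} (-1)^i W_i` equals
`S_k + (-1)^(k-1) Δ_k` (STATIC-PATH-NLOGN §1a; `fold_alt_eq`), hence the train at level `n` is, at every parameter, the distance between the
prefix-sum line of the ACTIVE INDEX and `S_n` (`Δ_eq_abs_sub`); consequently the linear pieces of the train `Δ_n` are governed by the
changes of the active index, which number at most `8 n + 9` along any increasing parameter sequence when the prefix-sum lines are pairwise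
distinct (`card_changes_le`, part 2) — the degeneracy-free form of the paper's Theorem P2 «pieces(Δ_n) ≤ 2n».  A statement about lines on
a path; nothing here asserts anything about `WeakLifting`, `TropicalB`, `KPlusLogSqLaw`, the stub in its window, `MatrixDescartes`
(stmt-ValiantsHypothesis-18050) or `VP ≠ VNP`.
-/

set_option linter.dupNamespace false
set_option autoImplicit false

namespace Summit.ValiantsHypothesis.ValiantsHypothesis.Theorems.KPlusLogSqLaw

open Set Classical

namespace StaticPathFold

noncomputable section

variable (w₁ w₀ : ℕ → ℝ)

/-- the signed prefix-sum line of index `t` is `S t = Σ_{i ≤ t} (-1)^i W i`: recursion `S (t+1) = S t + (-1)^(t+1) W (t+1)`. [folklore] -/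
theorem L_alt_succ (t : ℕ) (θ : ℝ) :
    L (altA w₁) (altB w₀) (t + 1) θ = L (altA w₁) (altB w₀) t θ + (-1) ^ (t + 1) * W w₁ w₀ (t + 1) θ := by
  unfold L W
  simp only [altA, altB]
  ring

/-- `S 0 = 0`. [folklore] -/
theorem L_alt_zero (θ : ℝ) : L (altA w₁) (altB w₀) 0 θ = 0 := by
  unfold L altA altB; ring

/-- the train is nonnegative. [folklore] -/
theorem Δ_nonneg (k : ℕ) (θ : ℝ) : 0 ≤ Δ w₁ w₀ k θ := by
  cases k with
  | zero => exact le_rfl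
  | succ k => rw [Δ_succ]; exact le_max_left _ _

/-- **the train is the increment of the prefix optimum**: `F (k+1) = F k + Δ (k+1)`. [folklore] -/
theorem F_succ_eq (k : ℕ) (θ : ℝ) : F w₁ w₀ (k + 1) θ = F w₁ w₀ k θ + Δ w₁ w₀ (k + 1) θ := by
  induction k with
  | zero =>
    show max 0 (W w₁ w₀ 1 θ) = 0 + max 0 (W w₁ w₀ (0 + 1) θ - Δ w₁ w₀ 0 θ)
    simp [Δ]
  | succ k ih =>
    rw [F_add_two, Δ_succ, ih]
    rcases le_total 0 (W w₁ w₀ (k + 1 + 1) θ - Δ w₁ w₀ (k + 1) θ) with h | h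
    · rw [max_eq_right h, max_eq_right (by linarith)]
      ring
    · rw [max_eq_left h, max_eq_left (by linarith)]
      ring

/-- **the fold is the prefix-sum line shifted by the train** (STATIC-PATH-NLOGN §1a):
`fold S k = S k + Δ k` for odd `k`, `S k - Δ k` for even `k`. [folklore] -/
theorem fold_alt_eq (k : ℕ) (θ : ℝ) :
    fold (altA w₁) (altB w₀) k θ =
      L (altA w₁) (altB w₀) k θ + (if Even k then -Δ w₁ w₀ k θ else Δ w₁ w₀ k θ) := by
  induction k with
  | zero => simp [fold_zero, Δ]
  | succ k ih =>
    rw [fold_succ, ih, Δ_succ, L_alt_succ]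
    by_cases he : Even (k + 1)
    · -- `k + 1` even: `k` odd, `(-1)^(k+1) = 1`, the fold takes a `min`
      have hk : ¬ Even k := fun h => Nat.even_add_one.mp he h
      rw [if_pos he, if_pos he, if_neg hk, Even.neg_one_pow he, one_mul]
      rcases le_total 0 (W w₁ w₀ (k + 1) θ - Δ w₁ w₀ k θ) with h | h
      · rw [max_eq_right h, min_eq_right (by linarith)]; ring
      · rw [max_eq_left h, min_eq_left (by linarith)]; ring
    · -- `k + 1` odd: `k` even, `(-1)^(k+1) = -1`, the fold takes a `max`
      have hk : Even k := by
        rcases Nat.even_or_odd k with h | h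
        · exact h
        · exact absurd (by rcases h with ⟨r, hr⟩; exact ⟨r + 1, by omega⟩) he
      have hodd : Odd (k + 1) := Nat.not_even_iff_odd.mp he
      rw [if_neg he, if_neg he, if_pos hk, Odd.neg_one_pow hodd, neg_one_mul]
      rcases le_total 0 (W w₁ w₀ (k + 1) θ - Δ w₁ w₀ k θ) with h | h
      · rw [max_eq_right h, max_eq_right (by linarith)]; ring
      · rw [max_eq_left h, max_eq_left (by linarith)]; ring

/-- **the train as the distance from the active prefix-sum line**: at every parameter,
`Δ n θ = |S (lab n θ) θ - S n θ|`, where `lab` is the active index of the alternating fold of `S_0, …, S_n`. [folklore] -/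
theorem Δ_eq_abs_sub (n : ℕ) (θ : ℝ) :
    Δ w₁ w₀ n θ = |L (altA w₁) (altB w₀) (lab (altA w₁) (altB w₀) n θ) θ - L (altA w₁) (altB w₀) n θ| := by
  have h1 := fold_alt_eq w₁ w₀ n θ
  rw [fold_eq_lab] at h1
  have h2 := Δ_nonneg w₁ w₀ n θ
  split_ifs at h1 with he
  · rw [abs_of_nonpos (by linarith)]; linarith
  · rw [abs_of_nonneg (by linarith)]; linarith

/-- **pieces of the train (degeneracy-free P2).**  Along any strictly increasing parameter sequence at which consecutive ACTIVE
INDICES of the fold of the prefix-sum lines differ, the length is at most `8 n + 9`, provided the prefix-sum lines `S_0, …, S_n` are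
pairwise distinct; between two consecutive changes the train `Δ n` is the fixed affine function `|S_j - S_n|` with one sign
(`Δ_eq_abs_sub`). [folklore] -/
theorem train_changes_le (n : ℕ)
    (hd : ∀ i j, i < j → j ≤ n → (altA w₁ i ≠ altA w₁ j ∨ altB w₀ i ≠ altB w₀ j)) (N : ℕ)
    (θs : Fin (N + 1) → ℝ) (hθ : StrictMono θs)
    (hch : ∀ e : Fin N, lab (altA w₁) (altB w₀) n (θs e.castSucc) ≠ lab (altA w₁) (altB w₀) n (θs e.succ)) :
    N ≤ 8 * n + 9 :=
  card_changes_le (altA w₁) (altB w₀) n hd N θs hθ hch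

end

end StaticPathFold

end Summit.ValiantsHypothesis.ValiantsHypothesis.Theorems.KPlusLogSqLaw
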